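import Mathlib
import Literature.Analysis.FluidPDE.SuitableWeak
import Literature.Analysis.FluidPDE.WeakGradientSlicing
import Literature.Analysis.FunctionSpaces.DistributionalConstancy
import Summits.NavierStokesRegularity.NavierStokesRegularity.Theorems.EulerZoomLiouvillePowerGaugeEulerLiouvilleDistributionallySteady
import Summits.NavierStokesRegularity.NavierStokesRegularity.Theorems.EulerZoomLiouvillePowerGaugeEulerLiouvilleAffineTimePast
import HarnessLib

/-!
# Crux `EulerZoomLiouville.PowerGaugeEulerLiouville` (stmt-NavierStokesRegularity-19832), stub `stub_nonSelfSimilarRest`: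
# `∂ₜ²u = 0` IN `𝒟'` ⇒ AFFINE IN TIME A.E. on a past slab (second-order parametric du Bois-Reymond, sliced in time) ⇒ TRIVIAL

Helper file (theorems only; `--supports stmt-NavierStokesRegularity-19832`; def-free).  Hand leafhand-ns-eulerzoomliouville-10 g4; the `𝒟'` half of the
affine-in-time stratum (hand 10 g3's census idea (L)), whose a.e. half is hand 11 g0's `…AffineTimePast` (imported, not restated).
* `DistAffine.exists_affine_of_forall_setIntegral_deriv_deriv_mul_eq_zero` — ONE VARIABLE: `E ∈ L¹((a,b))`, `∫_{(a,b)} η'' E = 0` for every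
  `η ∈ C_c^∞((a,b))` ⇒ `E(t) = α + β t` a.e. (the functional `φ ↦ ∫ φ' E` vanishes on derivatives of test functions, hence equals `κ ∫ φ` via
  `φ = (∫φ)ψ + η'`; then `∫ φ'·(E + κ t) = 0` by `∫ t φ'(t) dt = −∫ φ`, and the tree's first-order lemma `ae_eq_const_of_forall_setIntegral_deriv_mul_eq_zero`).
* `DistAffine.exists_ae_eq_affine` — SLAB: `u ∈ L¹_loc((−∞,T) × ℝ³)` with locally integrable a.e. slice and `∫∫ θ''(t) ⟪u(t,x), Φ(x)⟫ = 0` for all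
  `θ ∈ C_c^∞((−∞,T))`, all `Φ ∈ C_c(ℝ³;ℝ³)` ⇒ `u(t,x) = U₀(x) + t U₁(x)` a.e. (affine interpolation between two good slices; countable `C¹`-dense test
  families, `DistSteady.ae_eq_of_pairings_eq`, `FrameSteady.ae_zero_of_ae_slice`).
* `Loc.ae_eq_zero_of_distributionallyAffinePast` / `Birth.nonSelfSimilar_of_distributionallyAffinePast` — MEMBER LEVEL / binder language: a class member with
  `∂ₜ²u = 0` in `𝒟'((−∞,T₁) × ℝ³)`, `T₁ ≤ 0`, is trivial (`AffinePast.ae_eq_zero_of_gauge_of_aeAffinePast`, hand 11 g0).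
WHAT THIS IS NOT: nothing about Navier–Stokes; not a proof of the stub or of the crux. [folklore; Brezis2011 Lemma 8.1; Hörmander ALPDO I Thm 3.1.4]
-/

noncomputable section

-- flat `Theorems/<Route><Decl>…` files of one crux share the namespace of the crux (tree convention)
set_option linter.dupNamespace false

open MeasureTheory Set Filter Topology Metric Function TopologicalSpace
open scoped RealInnerProductSpace NNReal ENNReal ContDiff

namespace Summit.NavierStokesRegularity.NavierStokesRegularity.Theorems.PowerGaugeEulerLiouville

open Literature.Analysis Literature.Analysis.FunctionSpaces Literature.Analysis.FluidPDE

namespace DistAffine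

/-! ## 1. One variable: `E'' = 0` in `𝒟'((a,b))` ⇒ `E` is a.e. affine -/

/-- `∫_{(a,b)} φ'(t) t dt = −∫ φ` for a smooth `φ` compactly supported in `(a,b)` (integration by parts, no boundary terms). [folklore] -/
theorem setIntegral_deriv_mul_id {a b : ℝ} (hab : a < b) {φ : ℝ → ℝ} (hφ : ContDiff ℝ ∞ φ)
    (hφs : tsupport φ ⊆ Ioo a b) :
    ∫ t in Ioo a b, deriv φ t * t = -∫ t, φ t := by
  have hφa : φ a = 0 := image_eq_zero_of_notMem_tsupport fun h => (lt_irrefl a) (hφs h).1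
  have hφb : φ b = 0 := image_eq_zero_of_notMem_tsupport fun h => (lt_irrefl b) (hφs h).2
  have hd : Differentiable ℝ φ := hφ.differentiable (by simp)
  have hparts := intervalIntegral.integral_mul_deriv_eq_deriv_mul (a := a) (b := b) (u := fun x : ℝ => x)
    (u' := fun _ : ℝ => (1 : ℝ)) (v := φ) (v' := deriv φ) (fun x _ => hasDerivAt_id' x) (fun x _ => (hd x).hasDerivAt)
    intervalIntegrable_const ((hφ.continuous_deriv (by simp)).intervalIntegrable _ _)
  rw [hφa, hφb, mul_zero, mul_zero, sub_zero, zero_sub] at hparts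
  have hsupp : support φ ⊆ Ioc a b := fun t ht => Ioo_subset_Ioc_self (hφs (subset_tsupport _ ht))
  have e1 : (fun t => deriv φ t * t) = fun t => t * deriv φ t := funext fun t => mul_comm _ _
  rw [← integral_Ioc_eq_integral_Ioo, ← intervalIntegral.integral_of_le hab.le,
    ← intervalIntegral.integral_eq_integral_of_support_subset hsupp, e1, hparts]
  simp

/-- **`E'' = 0` in `𝒟'((a,b))` implies `E` is a.e. affine.**  If `E` is integrable on `(a, b)` and `∫_{(a,b)} η'' E = 0` for every smooth
compactly supported `η` with `tsupport η ⊆ (a, b)`, then `E(t) = α + β t` a.e. on `(a, b)` for some constants `α, β`.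
[cite: Brezis2011, Lemma 8.1; Hörmander ALPDO I, Thm 3.1.4] -/
theorem exists_affine_of_forall_setIntegral_deriv_deriv_mul_eq_zero {a b : ℝ} {E : ℝ → ℝ}
    (hE : IntegrableOn E (Ioo a b))
    (h : ∀ η : ℝ → ℝ, ContDiff ℝ ∞ η → HasCompactSupport η → tsupport η ⊆ Ioo a b →
      ∫ t in Ioo a b, deriv (deriv η) t * E t = 0) :
    ∃ α β : ℝ, ∀ᵐ t ∂(volume.restrict (Ioo a b)), E t = α + β * t := by
  rcases le_or_gt b a with hba | hab
  · refine ⟨0, 0, ?_⟩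
    rw [Ioo_eq_empty_of_le hba, Measure.restrict_empty, ae_zero]
    exact eventually_bot
  obtain ⟨ψ, hψs, hψc, hψsupp, hψ1⟩ := exists_contDiff_tsupport_subset_Ioo_integral_eq_one hab
  obtain ⟨a₁, b₁, ha₁, -, hb₁, hψz⟩ := exists_Icc_subset_Ioo_of_tsupport_subset hab hψc hψsupp
  set κ : ℝ := ∫ t in Ioo a b, deriv ψ t * E t with hκ
  -- Step 1: every test function `φ` on `(a, b)` satisfies `∫_{(a,b)} φ' E = (∫ φ) κ`.
  -- adapted from Literature/Analysis/FunctionSpaces/DistributionalConstancy.lean (`ae_eq_const_of_forall_setIntegral_deriv_mul_eq_zero`)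
  have hφE : ∀ φ : ℝ → ℝ, ContDiff ℝ ∞ φ → HasCompactSupport φ → tsupport φ ⊆ Ioo a b →
      ∫ t in Ioo a b, deriv φ t * E t = (∫ t, φ t) * κ := by
    intro φ hφs hφc hφsupp
    obtain ⟨a₂, b₂, ha₂, -, hb₂, hφz⟩ := exists_Icc_subset_Ioo_of_tsupport_subset hab hφc hφsupp
    set m : ℝ := ∫ t, φ t with hm
    set g : ℝ → ℝ := fun t => φ t - m * ψ t with hg
    have hgs : ContDiff ℝ ∞ g := hφs.sub (contDiff_const.mul hψs)
    have hgcont : Continuous g := hgs.continuous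
    set a' : ℝ := (a + min a₁ a₂) / 2 with ha'
    set b' : ℝ := (b + max b₁ b₂) / 2 with hb'
    have haa' : a < a' := by rw [ha']; have := lt_min ha₁ ha₂; linarith
    have hb'b : b' < b := by rw [hb']; have := max_lt hb₁ hb₂; linarith
    have hgz : ∀ t, g t ≠ 0 → t ∈ Ioo a' b' := fun t ht => by
      have h' : φ t ≠ 0 ∨ ψ t ≠ 0 := by
        by_contra hcon
        simp only [not_or, not_not] at hcon
        exact ht (by simp only [hg, hcon.1, hcon.2, mul_zero, sub_zero])
      have hmin : min a₁ a₂ ≤ t ∧ t ≤ max b₁ b₂ := by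
        rcases h' with h' | h'
        · exact ⟨(min_le_right _ _).trans (hφz t h').1, (hφz t h').2.trans (le_max_right _ _)⟩
        · exact ⟨(min_le_left _ _).trans (hψz t h').1, (hψz t h').2.trans (le_max_left _ _)⟩
      have h1 := lt_min ha₁ ha₂
      have h2 := max_lt hb₁ hb₂
      constructor
      · rw [ha']; linarith [hmin.1]
      · rw [hb']; linarith [hmin.2]
    have hφi : Integrable φ volume := hφs.continuous.integrable_of_hasCompactSupport hφc
    have hψi : Integrable ψ volume := hψs.continuous.integrable_of_hasCompactSupport hψc
    have hg0 : ∫ t, g t = 0 := by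
      simp only [hg]
      rw [integral_sub hφi (hψi.const_mul m), MeasureTheory.integral_const_mul, hψ1, mul_one, sub_self]
    -- the primitive `η(t) = ∫ₐᵗ g` is a test function on `(a, b)` with `η' = g`, `η'' = g' = φ' − m ψ'`
    set η : ℝ → ℝ := fun t => ∫ s in a..t, g s with hη
    have hηs : ContDiff ℝ ∞ η := contDiff_primitive hgs a
    have hηd : ∀ t, HasDerivAt η (g t) t := fun t => (hgcont.integral_hasStrictDerivAt a t).hasDerivAt
    have hηz : ∀ t, t ∉ Ioo a' b' → η t = 0 := fun t ht => by
      refine primitive_eq_zero_of_integral_eq_zero haa'.le hgz hg0 t ?_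
      simp only [mem_Ioo, not_and_or, not_lt] at ht
      exact ht
    have hηsub : tsupport η ⊆ Icc a' b' :=
      closure_minimal (fun t ht => by
        by_contra h'
        exact ht (hηz t fun h'' => h' (Ioo_subset_Icc_self h''))) isClosed_Icc
    have hηc : HasCompactSupport η :=
      HasCompactSupport.of_support_subset_isCompact isCompact_Icc ((subset_tsupport η).trans hηsub)
    have hηsupp : tsupport η ⊆ Ioo a b := hηsub.trans (Icc_subset_Ioo haa' hb'b)
    have key := h η hηs hηc hηsupp
    have hderiv : deriv η = g := funext fun t => (hηd t).deriv
    have hderiv2 : deriv (deriv η) = fun t => deriv φ t - m * deriv ψ t := by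
      rw [hderiv]
      funext t
      have h1 : DifferentiableAt ℝ φ t := (hφs.differentiable (by simp)) t
      have h2 : DifferentiableAt ℝ ψ t := (hψs.differentiable (by simp)) t
      have e : g = fun s => φ s - m * ψ s := rfl
      rw [e, deriv_fun_sub h1 (h2.const_mul m), deriv_const_mul m h2]
    rw [hderiv2] at key
    have hφ'Ei : IntegrableOn (fun t => deriv φ t * E t) (Ioo a b) :=
      integrableOn_continuous_mul_of_hasCompactSupport hE (hφs.continuous_deriv (by simp)) hφc.deriv
    have hψ'Ei : IntegrableOn (fun t => deriv ψ t * E t) (Ioo a b) :=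
      integrableOn_continuous_mul_of_hasCompactSupport hE (hψs.continuous_deriv (by simp)) hψc.deriv
    have hsplit : ∫ t in Ioo a b, (deriv φ t - m * deriv ψ t) * E t =
        (∫ t in Ioo a b, deriv φ t * E t) - m * ∫ t in Ioo a b, deriv ψ t * E t := by
      rw [← MeasureTheory.integral_const_mul, ← integral_sub hφ'Ei (hψ'Ei.const_mul m)]
      exact integral_congr_ae (Eventually.of_forall fun t => by simp only; ring)
    rw [hsplit, sub_eq_zero] at key
    rw [key]
  -- Step 2: `E + κ t` has vanishing distributional derivative on `(a, b)`.
  have hlin : IntegrableOn (fun t : ℝ => κ * t) (Ioo a b) :=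
    ((continuous_const.mul continuous_id).integrableOn_Icc (μ := volume) (a := a) (b := b)).mono_set Ioo_subset_Icc_self
  have hE₁ : IntegrableOn (fun t => E t + κ * t) (Ioo a b) := hE.add hlin
  have h1 : ∀ φ : ℝ → ℝ, ContDiff ℝ ∞ φ → HasCompactSupport φ → tsupport φ ⊆ Ioo a b →
      ∫ t in Ioo a b, deriv φ t * (E t + κ * t) = 0 := by
    intro φ hφs hφc hφsupp
    have hφ'Ei : IntegrableOn (fun t => deriv φ t * E t) (Ioo a b) :=
      integrableOn_continuous_mul_of_hasCompactSupport hE (hφs.continuous_deriv (by simp)) hφc.deriv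
    have hφ'ti : IntegrableOn (fun t => deriv φ t * (κ * t)) (Ioo a b) :=
      integrableOn_continuous_mul_of_hasCompactSupport hlin (hφs.continuous_deriv (by simp)) hφc.deriv
    have e1 : ∫ t in Ioo a b, deriv φ t * (E t + κ * t) =
        (∫ t in Ioo a b, deriv φ t * E t) + κ * ∫ t in Ioo a b, deriv φ t * t := by
      rw [← MeasureTheory.integral_const_mul, ← integral_add hφ'Ei (hφ'ti.congr (Eventually.of_forall fun t => by
        simp only; ring))]
      exact integral_congr_ae (Eventually.of_forall fun t => by simp only; ring)
    rw [e1, hφE φ hφs hφc hφsupp, setIntegral_deriv_mul_id hab hφs hφsupp]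
    ring
  obtain ⟨α, hα⟩ := ae_eq_const_of_forall_setIntegral_deriv_mul_eq_zero hE₁ h1
  refine ⟨α, -κ, ?_⟩
  filter_upwards [hα] with t ht
  linarith

/-! ## 2. The slab: pairings are a.e. affine on every compact time window -/

variable {u : ℝ → EuclideanSpace ℝ (Fin 3) → EuclideanSpace ℝ (Fin 3)} {T : ℝ}

/-- **On each window the pairing `g(t) = ∫ χ ⟪u(t), e⟫` is a.e. affine**, `g(t) = α + β t`, whenever `∫∫ θ''(t)⟪u(t,x), Φ(x)⟫ = 0` for all
`θ ∈ C_c^∞((−∞,T))` and all continuous compactly supported `Φ`. [folklore; Brezis2011 Lemma 8.1] -/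
theorem exists_pairing_ae_affine
    (hu : LocallyIntegrableOn (uncurry u) (Iio T ×ˢ (univ : Set (EuclideanSpace ℝ (Fin 3)))) volume)
    (haff : ∀ θ : ℝ → ℝ, ContDiff ℝ ∞ θ → HasCompactSupport θ → tsupport θ ⊆ Iio T →
      ∀ Φ : EuclideanSpace ℝ (Fin 3) → EuclideanSpace ℝ (Fin 3), Continuous Φ → HasCompactSupport Φ →
        ∫ z : ℝ × EuclideanSpace ℝ (Fin 3), deriv (deriv θ) z.1 * ⟪u z.1 z.2, Φ z.2⟫ = 0)
    {a b : ℝ} (hbT : b < T) {χ : EuclideanSpace ℝ (Fin 3) → ℝ} (hχ : Continuous χ) (hχc : HasCompactSupport χ)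
    (e : EuclideanSpace ℝ (Fin 3)) :
    ∃ αβ : ℝ × ℝ, ∀ᵐ t ∂(volume.restrict (Ioo a b)), ∫ x, χ x * ⟪u t x, e⟫ = αβ.1 + αβ.2 * t := by
  obtain ⟨α, β, h⟩ := exists_affine_of_forall_setIntegral_deriv_deriv_mul_eq_zero (a := a) (b := b)
    (DistSteady.integrableOn_pairing hu hbT hχ hχc e) (fun θ hθ hθc hθab => by
      have hθT : tsupport θ ⊆ Iio T := hθab.trans fun t ht => ht.2.trans hbT
      exact DistSteady.setIntegral_deriv_mul_pairing_eq_zero hu hbT.le hχ hχc e (hθ.deriv') hθc.deriv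
        (tsupport_deriv_subset.trans hθab)
        (haff θ hθ hθc hθT _ (hχ.smul continuous_const) (hχc.smul_right (f' := fun _ : EuclideanSpace ℝ (Fin 3) => e))))
  exact ⟨(α, β), h⟩

/-- Pairings of an affine interpolation: `∫ χ ⟪f₀ + k (f₁ − f₀), e⟫ = ∫ χ⟪f₀,e⟫ + k (∫ χ⟪f₁,e⟫ − ∫ χ⟪f₀,e⟫)`. [folklore] -/
theorem integral_pairing_interp {f₀ f₁ : EuclideanSpace ℝ (Fin 3) → EuclideanSpace ℝ (Fin 3)}
    (hf₀ : LocallyIntegrable f₀ volume) (hf₁ : LocallyIntegrable f₁ volume)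
    {χ : EuclideanSpace ℝ (Fin 3) → ℝ} (hχ : Continuous χ) (hχc : HasCompactSupport χ) (e : EuclideanSpace ℝ (Fin 3)) (k : ℝ) :
    ∫ x, χ x * ⟪f₀ x + k • (f₁ x - f₀ x), e⟫ =
      (∫ x, χ x * ⟪f₀ x, e⟫) + k * ((∫ x, χ x * ⟪f₁ x, e⟫) - ∫ x, χ x * ⟪f₀ x, e⟫) := by
  have hK : IsCompact (tsupport χ) := hχc
  have hz : ∀ x ∉ tsupport χ, χ x = 0 := fun x hx => image_eq_zero_of_notMem_tsupport hx
  have i₀ : Integrable (fun x => χ x * ⟪f₀ x, e⟫) volume :=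
    integrable_mul_of_eq_zero_off_compact hK hχ hz ((hf₀.integrableOn_isCompact hK).inner_const e)
  have i₁ : Integrable (fun x => χ x * ⟪f₁ x, e⟫) volume :=
    integrable_mul_of_eq_zero_off_compact hK hχ hz ((hf₁.integrableOn_isCompact hK).inner_const e)
  have e1 : (fun x => χ x * ⟪f₀ x + k • (f₁ x - f₀ x), e⟫) =
      fun x => χ x * ⟪f₀ x, e⟫ + k * (χ x * ⟪f₁ x, e⟫ - χ x * ⟪f₀ x, e⟫) := by
    funext x
    rw [inner_add_left, inner_smul_left, inner_sub_left]
    simp only [conj_trivial]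
    ring
  have i₂ : Integrable (fun x => k * (χ x * ⟪f₁ x, e⟫ - χ x * ⟪f₀ x, e⟫)) volume := (i₁.sub i₀).const_mul k
  rw [e1, integral_add i₀ i₂, MeasureTheory.integral_const_mul, integral_sub i₁ i₀]

/-! ## 3. `∂ₜ²u = 0` in `𝒟'` ⇒ a.e. affine in time -/

/-- **`∂ₜ²u = 0` IN `𝒟'` ⇒ A.E. AFFINE IN TIME.**  Let `u` be locally integrable on the slab `(−∞,T) × ℝ³` with locally integrable slices `u(t)` for
a.e. `t < T`, and suppose `∫∫ θ''(t) ⟪u(t,x), Φ(x)⟫ = 0` for every `θ ∈ C_c^∞((−∞,T))` and every continuous compactly supported field `Φ`.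
Then there are locally integrable `U₀, U₁ : ℝ³ → ℝ³` with `u(t, x) = U₀(x) + t U₁(x)` for a.e. `(t, x) ∈ (−∞,T) × ℝ³`. [folklore; Brezis2011 Lemma 8.1] -/
theorem exists_ae_eq_affine
    (hu : LocallyIntegrableOn (uncurry u) (Iio T ×ˢ (univ : Set (EuclideanSpace ℝ (Fin 3)))) volume)
    (hsl : ∀ᵐ t ∂(volume.restrict (Iio T)), LocallyIntegrable (u t) volume)
    (haff : ∀ θ : ℝ → ℝ, ContDiff ℝ ∞ θ → HasCompactSupport θ → tsupport θ ⊆ Iio T →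
      ∀ Φ : EuclideanSpace ℝ (Fin 3) → EuclideanSpace ℝ (Fin 3), Continuous Φ → HasCompactSupport Φ →
        ∫ z : ℝ × EuclideanSpace ℝ (Fin 3), deriv (deriv θ) z.1 * ⟪u z.1 z.2, Φ z.2⟫ = 0) :
    ∃ U₀ U₁ : EuclideanSpace ℝ (Fin 3) → EuclideanSpace ℝ (Fin 3), LocallyIntegrable U₀ volume ∧ LocallyIntegrable U₁ volume ∧
      ∀ᵐ z ∂(volume.restrict (Iio T ×ˢ (univ : Set (EuclideanSpace ℝ (Fin 3))))), u z.1 z.2 = U₀ z.2 + z.1 • U₁ z.2 := by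
  classical
  -- adapted from Theorems/EulerZoomLiouvillePowerGaugeEulerLiouvilleDistributionallySteady.lean (`DistSteady.exists_ae_eq_slice`)
  -- countable dense families of spatial test functions supported in the closed balls
  have hfam : ∀ n : ℕ, ∃ D : Set (EuclideanSpace ℝ (Fin 3) → ℝ), D.Countable ∧
      (∀ ψ ∈ D, IsTestFunctionOn (⊤ : Opens (EuclideanSpace ℝ (Fin 3))) ψ ∧ tsupport ψ ⊆ closedBall (0 : EuclideanSpace ℝ (Fin 3)) n) ∧
      ∀ ψ : EuclideanSpace ℝ (Fin 3) → ℝ, IsTestFunctionOn (⊤ : Opens (EuclideanSpace ℝ (Fin 3))) ψ →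
        tsupport ψ ⊆ closedBall (0 : EuclideanSpace ℝ (Fin 3)) n →
          ∃ s : ℕ → EuclideanSpace ℝ (Fin 3) → ℝ, (∀ k, s k ∈ D) ∧ TendstoUniformly s ψ atTop ∧
            TendstoUniformly (fun k => fderiv ℝ (s k)) (fderiv ℝ ψ) atTop := fun n =>
    exists_countable_testFunctions_dense (⊤ : Opens (EuclideanSpace ℝ (Fin 3))) (isCompact_closedBall 0 n)
  choose D hDc hD hDd using hfam
  -- windows `(T - m - 2, T - 1/(m+1))` exhausting `(−∞, T)`
  set wa : ℕ → ℝ := fun m => T - m - 2 with hwa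
  set wb : ℕ → ℝ := fun m => T - 1 / ((m : ℝ) + 1) with hwb
  have hwbT : ∀ m, wb m < T := fun m => by
    simp only [hwb]
    have : (0 : ℝ) < 1 / ((m : ℝ) + 1) := by positivity
    linarith
  -- every finite set of times `< T` lies in a common window
  have hwin : ∀ t : ℝ, t < T → ∃ M : ℕ, ∀ m : ℕ, M ≤ m → t ∈ Ioo (wa m) (wb m) := by
    intro t htT
    obtain ⟨N₁, hN₁⟩ := exists_nat_gt (T - t)
    obtain ⟨N₂, hN₂⟩ := exists_nat_gt (1 / (T - t))
    refine ⟨max N₁ N₂, fun m hm => ⟨?_, ?_⟩⟩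
    · simp only [hwa]
      have h1 : (N₁ : ℝ) ≤ m := by exact_mod_cast (le_max_left N₁ N₂).trans hm
      linarith
    · simp only [hwb]
      have h1 : (N₂ : ℝ) ≤ m := by exact_mod_cast (le_max_right N₁ N₂).trans hm
      have hδ : 0 < T - t := by linarith
      have h3 : 1 / (T - t) < (m : ℝ) + 1 := by linarith
      have h4 : 1 / ((m : ℝ) + 1) < T - t := by
        rw [div_lt_iff₀ (by positivity)]
        rw [div_lt_iff₀ hδ] at h3
        linarith
      linarith
  -- the affine laws of the pairings on each window
  have hconst : ∀ (m n : ℕ) (χ : D n) (i : Fin 3), ∃ αβ : ℝ × ℝ, ∀ᵐ t ∂(volume.restrict (Ioo (wa m) (wb m))),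
      ∫ x, (χ : EuclideanSpace ℝ (Fin 3) → ℝ) x * ⟪u t x, EuclideanSpace.single i (1 : ℝ)⟫ = αβ.1 + αβ.2 * t := fun m n χ i =>
    exists_pairing_ae_affine hu haff (hwbT m) (hD n χ χ.2).1.contDiff.continuous (hD n χ χ.2).1.hasCompactSupport _
  choose C hC using hconst
  -- good times
  have hcount : ∀ n, Countable (D n) := fun n => (hDc n).to_subtype
  have hgood : ∀ᵐ t ∂(volume.restrict (Iio T)), LocallyIntegrable (u t) volume ∧
      ∀ (m n : ℕ) (χ : D n) (i : Fin 3), t ∈ Ioo (wa m) (wb m) →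
        ∫ x, (χ : EuclideanSpace ℝ (Fin 3) → ℝ) x * ⟪u t x, EuclideanSpace.single i (1 : ℝ)⟫ = (C m n χ i).1 + (C m n χ i).2 * t := by
    refine hsl.and ?_
    refine ae_all_iff.2 fun m => ae_all_iff.2 fun n => ae_all_iff.2 fun χ => ae_all_iff.2 fun i => ?_
    have h1 := hC m n χ i
    have h2 : ∀ᵐ t ∂(volume : Measure ℝ), t ∈ Ioo (wa m) (wb m) →
        ∫ x, (χ : EuclideanSpace ℝ (Fin 3) → ℝ) x * ⟪u t x, EuclideanSpace.single i (1 : ℝ)⟫ = (C m n χ i).1 + (C m n χ i).2 * t :=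
      ae_imp_of_ae_restrict h1
    exact ae_restrict_of_ae h2
  -- two distinct good reference times
  have hpos : (volume : Measure ℝ) (Iio T) ≠ 0 := by
    rw [Real.volume_Iio]; exact ENNReal.top_ne_zero
  obtain ⟨t₀, ht₀T, ht₀l, ht₀C⟩ := Measure.exists_mem_of_measure_ne_zero_of_ae hpos hgood
  have hne : ∀ᵐ t ∂(volume.restrict (Iio T)), t ≠ t₀ := by
    have h : (volume.restrict (Iio T)) {t₀} = 0 := measure_singleton t₀
    exact compl_mem_ae_iff.2 h
  obtain ⟨t₁, ht₁T, ⟨ht₁l, ht₁C⟩, ht₁ne⟩ := Measure.exists_mem_of_measure_ne_zero_of_ae hpos (hgood.and hne)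
  have hd : t₁ - t₀ ≠ 0 := sub_ne_zero.2 ht₁ne
  set U₁ : EuclideanSpace ℝ (Fin 3) → EuclideanSpace ℝ (Fin 3) := fun x => (t₁ - t₀)⁻¹ • (u t₁ x - u t₀ x) with hU₁
  set U₀ : EuclideanSpace ℝ (Fin 3) → EuclideanSpace ℝ (Fin 3) := fun x => u t₀ x - t₀ • U₁ x with hU₀
  have hU₁l : LocallyIntegrable U₁ volume := by
    have h := (ht₁l.sub ht₀l).smul ((t₁ - t₀)⁻¹ : ℝ)
    exact h
  have hU₀l : LocallyIntegrable U₀ volume := by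
    have h := ht₀l.sub (hU₁l.smul t₀)
    exact h
  refine ⟨U₀, U₁, hU₀l, hU₁l, ?_⟩
  -- the affine field at time `t` is the affine interpolation between the two reference slices
  have hinterp : ∀ t : ℝ, ∀ x, U₀ x + t • U₁ x = u t₀ x + ((t - t₀) * (t₁ - t₀)⁻¹) • (u t₁ x - u t₀ x) := by
    intro t x
    simp only [hU₀, hU₁, smul_smul]
    rw [sub_mul, sub_smul]
    abel
  -- every good time has the affine slice
  have hslice : ∀ᵐ t ∂(volume.restrict (Iio T)), (fun x => u t x - (U₀ x + t • U₁ x)) =ᵐ[volume] 0 := by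
    rw [ae_restrict_iff' measurableSet_Iio] at hgood ⊢
    filter_upwards [hgood] with t hgt htT
    obtain ⟨htl, htC⟩ := hgt htT
    -- a common window containing `t`, `t₀`, `t₁`
    obtain ⟨M, hM⟩ := hwin t htT
    obtain ⟨M₀, hM₀⟩ := hwin t₀ ht₀T
    obtain ⟨M₁, hM₁⟩ := hwin t₁ ht₁T
    set m : ℕ := max M (max M₀ M₁) with hm
    have hmt : t ∈ Ioo (wa m) (wb m) := hM m (le_max_left _ _)
    have hmt₀ : t₀ ∈ Ioo (wa m) (wb m) := hM₀ m ((le_max_left _ _).trans (le_max_right _ _))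
    have hmt₁ : t₁ ∈ Ioo (wa m) (wb m) := hM₁ m ((le_max_right _ _).trans (le_max_right _ _))
    have hVl : LocallyIntegrable (fun x => U₀ x + t • U₁ x) volume := by
      have h := hU₀l.add (hU₁l.smul t)
      exact h
    have heq : ∀ n, ∀ χ ∈ D n, ∀ i : Fin 3,
        ∫ x, χ x * ⟪u t x, EuclideanSpace.single i (1 : ℝ)⟫ = ∫ x, χ x * ⟪U₀ x + t • U₁ x, EuclideanSpace.single i (1 : ℝ)⟫ := by
      intro n χ hχ i
      have hχT := (hD n χ hχ).1
      have e1 : (fun x => χ x * ⟪U₀ x + t • U₁ x, EuclideanSpace.single i (1 : ℝ)⟫) =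
          fun x => χ x * ⟪u t₀ x + ((t - t₀) * (t₁ - t₀)⁻¹) • (u t₁ x - u t₀ x), EuclideanSpace.single i (1 : ℝ)⟫ := by
        funext x; rw [hinterp t x]
      rw [e1, integral_pairing_interp ht₀l ht₁l hχT.contDiff.continuous hχT.hasCompactSupport _ _,
        htC m n ⟨χ, hχ⟩ i hmt, ht₀C m n ⟨χ, hχ⟩ i hmt₀, ht₁C m n ⟨χ, hχ⟩ i hmt₁]
      field_simp
      ring
    have h := DistSteady.ae_eq_of_pairings_eq htl hVl hD hDd heq
    filter_upwards [h] with x hx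
    simp [hx]
  -- slices to slab
  have hprod : (volume.restrict (Iio T ×ˢ (univ : Set (EuclideanSpace ℝ (Fin 3)))) : Measure (ℝ × EuclideanSpace ℝ (Fin 3))) =
      ((volume : Measure ℝ).restrict (Iio T)).prod (volume : Measure (EuclideanSpace ℝ (Fin 3))) := by
    rw [Measure.volume_eq_prod, ← Measure.restrict_univ (μ := (volume : Measure (EuclideanSpace ℝ (Fin 3)))),
      Measure.prod_restrict, Measure.restrict_univ]
  have hmeas : AEStronglyMeasurable (uncurry fun t x => u t x - (U₀ x + t • U₁ x))
      (volume.restrict (Iio T ×ˢ (univ : Set (EuclideanSpace ℝ (Fin 3))))) := by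
    have h1 : AEStronglyMeasurable (uncurry u) (volume.restrict (Iio T ×ˢ (univ : Set (EuclideanSpace ℝ (Fin 3))))) :=
      hu.aestronglyMeasurable
    have h2 : AEStronglyMeasurable (fun z : ℝ × EuclideanSpace ℝ (Fin 3) => U₀ z.2 + z.1 • U₁ z.2)
        (volume.restrict (Iio T ×ˢ (univ : Set (EuclideanSpace ℝ (Fin 3))))) := by
      rw [hprod]
      exact hU₀l.aestronglyMeasurable.comp_snd.add
        ((continuous_fst.aestronglyMeasurable).smul hU₁l.aestronglyMeasurable.comp_snd)
    exact h1.sub h2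
  have h0 := FrameSteady.ae_zero_of_ae_slice hmeas hslice
  filter_upwards [h0] with z hz
  exact sub_eq_zero.1 hz

end DistAffine

/-! ## 4. Member level and binder language -/

/-- **`∂ₜ²u = 0` IN `𝒟'` ON A PAST SLAB ⇒ TRIVIAL** (member level, every `ρ > 0`, no regularity beyond the class, no ansatz).  Crux hypotheses
verbatim, `T₁ ≤ 0`, and `∫∫ θ''(t) ⟪u(t,x), Φ(x)⟫ = 0` for every `θ ∈ C_c^∞((−∞,T₁))` and every continuous compactly supported `Φ`.  Then `u = 0`
a.e. on the slab: `u` is a.e. affine in time on the past slab (`DistAffine.exists_ae_eq_affine`) and hand 11 g0's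
`AffinePast.ae_eq_zero_of_gauge_of_aeAffinePast` applies. [folklore] -/
theorem Loc.ae_eq_zero_of_distributionallyAffinePast {ρ : ℝ} (hρ : 0 < ρ)
    {u : ℝ → EuclideanSpace ℝ (Fin 3) → EuclideanSpace ℝ (Fin 3)} {p : ℝ → EuclideanSpace ℝ (Fin 3) → ℝ}
    {H : ℝ → EuclideanSpace ℝ (Fin 3) → EuclideanSpace ℝ (Fin 3) →L[ℝ] EuclideanSpace ℝ (Fin 3)} {c : ℝ≥0}
    (hsw : IsSuitableWeakSolutionOn (slab (EuclideanSpace ℝ (Fin 3)) (Iio 0) isOpen_Iio) 0 0 u p)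
    (hH : HasWeakSpatialGradientOn (slab (EuclideanSpace ℝ (Fin 3)) (Iio 0) isOpen_Iio) u H)
    (hc : ∀ a : ℝ, 0 < a → ENNReal.ofReal (a ^ (2 * ρ)) * cknA a (0 : ℝ × EuclideanSpace ℝ (Fin 3)) u +
        ENNReal.ofReal (a ^ ρ) * cknE a (0 : ℝ × EuclideanSpace ℝ (Fin 3)) H +
        ENNReal.ofReal (a ^ (2 * ρ)) * cknD a (0 : ℝ × EuclideanSpace ℝ (Fin 3)) p ≤ (c : ℝ≥0∞))
    {T₁ : ℝ} (hT₁ : T₁ ≤ 0)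
    (haff : ∀ θ : ℝ → ℝ, ContDiff ℝ ∞ θ → HasCompactSupport θ → tsupport θ ⊆ Iio T₁ →
      ∀ Φ : EuclideanSpace ℝ (Fin 3) → EuclideanSpace ℝ (Fin 3), Continuous Φ → HasCompactSupport Φ →
        ∫ z : ℝ × EuclideanSpace ℝ (Fin 3), deriv (deriv θ) z.1 * ⟪u z.1 z.2, Φ z.2⟫ = 0) :
    uncurry u =ᵐ[volume.restrict (Iio (0 : ℝ) ×ˢ (univ : Set (EuclideanSpace ℝ (Fin 3))))] 0 := by
  have hu : LocallyIntegrableOn (uncurry u) (Iio T₁ ×ˢ (univ : Set (EuclideanSpace ℝ (Fin 3)))) volume := by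
    have h0 : LocallyIntegrableOn (uncurry u) (Iio (0 : ℝ) ×ˢ (univ : Set (EuclideanSpace ℝ (Fin 3)))) volume := by
      simpa only [coe_slab] using hsw.distributional.1
    exact h0.mono_set (prod_mono (Iio_subset_Iio hT₁) Subset.rfl)
  have hsl : ∀ᵐ t ∂(volume.restrict (Iio T₁)), LocallyIntegrable (u t) volume := by
    filter_upwards [FrameSteady.ae_hasWeakFDerivOn_slice_past hH hT₁] with t ht
    exact locallyIntegrableOn_univ.1 (by simpa only [Opens.coe_top] using ht.locallyIntegrableOn)
  obtain ⟨U₀, U₁, -, -, hU⟩ := DistAffine.exists_ae_eq_affine hu hsl haff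
  exact AffinePast.ae_eq_zero_of_gauge_of_aeAffinePast hρ hsw hH hc hT₁ hU

/-- **Binder language: NO MEMBER HAS `∂ₜ²u = 0` IN `𝒟'` ON A PAST SLAB** (every `ρ > 0`, no regularity beyond the class, no ansatz): a class member with
`∫∫ θ''(t)⟪u(t,x), Φ(x)⟫ = 0` for all `θ ∈ C_c^∞((−∞,T₁))`, all continuous compactly supported `Φ`, some `T₁ ≤ 0`, is trivial — a closed
sub-stratum of `stub_nonSelfSimilarRest` containing `Birth.nonSelfSimilar_of_distributionallySteadyPast` (hand 10 g3) and
`Birth.nonSelfSimilar_of_aeAffineTimePast` (hand 11 g0). [folklore] -/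
theorem Birth.nonSelfSimilar_of_distributionallyAffinePast :
    ∀ ρ : ℝ, 0 < ρ →
      ∀ (u : ℝ → EuclideanSpace ℝ (Fin 3) → EuclideanSpace ℝ (Fin 3)) (p : ℝ → EuclideanSpace ℝ (Fin 3) → ℝ)
        (H : ℝ → EuclideanSpace ℝ (Fin 3) → EuclideanSpace ℝ (Fin 3) →L[ℝ] EuclideanSpace ℝ (Fin 3)) (c : ℝ≥0),
        Birth.InClass ρ u p H c →
          (∃ T₁ : ℝ, T₁ ≤ 0 ∧ ∀ θ : ℝ → ℝ, ContDiff ℝ ∞ θ → HasCompactSupport θ → tsupport θ ⊆ Iio T₁ →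
              ∀ Φ : EuclideanSpace ℝ (Fin 3) → EuclideanSpace ℝ (Fin 3), Continuous Φ → HasCompactSupport Φ →
                ∫ z : ℝ × EuclideanSpace ℝ (Fin 3), deriv (deriv θ) z.1 * ⟪u z.1 z.2, Φ z.2⟫ = 0) →
          uncurry u =ᵐ[volume.restrict (Iio (0 : ℝ) ×ˢ (univ : Set (EuclideanSpace ℝ (Fin 3))))] 0 := by
  intro ρ hρ u p H c hcl h
  obtain ⟨T₁, hT₁, haff⟩ := h
  exact Loc.ae_eq_zero_of_distributionallyAffinePast hρ hcl.1 hcl.2.1 hcl.2.2 hT₁ haff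

end Summit.NavierStokesRegularity.NavierStokesRegularity.Theorems.PowerGaugeEulerLiouville

end
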